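import Summits.ValiantsHypothesis.ValiantsHypothesis.Theorems.LacunarySymmetroidMatrixDescartesCensusReflect

/-!
# `MatrixDescartes` census — reflective certificates with a GAUSSIAN sign-of-determinant (`m = 7, 8` rows in seconds)

HONEST FRAMING.  Verification infrastructure for the finite census of real symmetric lacunary pencils (cells
`pub-symmetroid`, `val-V1-extremal`; seat val-v1x-eng-8, on top of val-v1x-eng-10's reflective kit `…CensusReflect`).
Nothing here bears on the asymptotic crux `Theses.LacunarySymmetroid.MatrixDescartes` (stmt-ValiantsHypothesis-18050) nor on
`VP ≠ VNP`.

WHAT IT DOES.  `…CensusReflect.certCheck` evaluates the SIGN of `det` of an integer matrix by the Laplace expansion `idet`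
(`m!` products per test point: fine for `m ≤ 6`, too slow for `m = 7, 8`).  Here `gsign n M` computes the same sign by
fraction-free GAUSSIAN elimination: pick the first nonzero entry `p = M i 0` of column `0`, replace every other row `r` by
`p • row r − (M r 0) • row i` (determinant multiplied by `p ^ n`), expand along column `0` (only the pivot survives:
`(−1)^i · p · det S`), divide every row of the `n × n` remainder `S` by its (positive) content — which never changes a sign — and
recurse: `sign det M = (−1)^i · sign(p)^(n+1) · sign det S`.  Soundness `gsign_eq : gsign n M = Int.sign (det M)` is proved once
(`Matrix.det_mul_column`, `Matrix.det_eq_of_forall_row_eq_smul_add_const`, `Matrix.det_succ_column_zero`).  `certCheckG` is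
`certCheck` with `gsign` in place of `Int.sign ∘ idet`; `certCheckG_eq : certCheckG = certCheck` pointwise, so
`not_posRootLawAt_of_certCheckG` is eng-10's soundness theorem verbatim.  Cost per test point ≈ `m³` big-integer operations with
Bareiss-size intermediates instead of `m!` products.

[folklore] Gaussian elimination / Laplace expansion; proof by reflection.
-/

-- `Summit.ValiantsHypothesis.ValiantsHypothesis.…` repeats a component by the D-0017 layout
-- (single-conjunct summit), which the `dupNamespace` linter flags; the name is mandated.
set_option linter.dupNamespace false

namespace Summit.ValiantsHypothesis.ValiantsHypothesis.Theorems.LacunarySymmetroidMatrixDescartes.Census.Reflect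

open Summit.ValiantsHypothesis.ValiantsHypothesis.Theorems.MatrixDescartes.Negative (PosRootLawAt)
open scoped BigOperators Matrix

/-! ### Kernel-reducible primitives -/

/-- First index `i` (in increasing order) with `f i ≠ 0`, if any (structural recursion, kernel-reducible). [folklore] -/
def firstNz : (n : ℕ) → (Fin n → ℤ) → Option (Fin n)
  | 0, _ => none
  | n + 1, f => if f 0 ≠ 0 then some 0 else (firstNz n (fun i => f i.succ)).map Fin.succ

/-- Row content used for the size reduction: `gcd` of the absolute values of a row, but at least `1`. [folklore] -/
def rowContent (n : ℕ) (f : Fin n → ℤ) : ℕ :=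
  max 1 (finGcd n f)
where
  /-- structural gcd over `Fin n`. -/
  finGcd : (n : ℕ) → (Fin n → ℤ) → ℕ
  | 0, _ => 0
  | n + 1, f => Nat.gcd (f 0).natAbs (finGcd n (fun i => f i.succ))

/-- **Gaussian sign of the determinant** of an integer `n × n` matrix (see the module docstring). [folklore] -/
def gsign : (n : ℕ) → (Fin n → Fin n → ℤ) → ℤ
  | 0, _ => 1
  | n + 1, M =>
    match firstNz (n + 1) (fun r => M r 0) with
    | none => 0
    | some i =>
      let p : ℤ := M i 0
      let S₀ : Fin n → Fin n → ℤ := fun r c => p * M (i.succAbove r) c.succ - M (i.succAbove r) 0 * M i c.succ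
      let g : Fin n → ℕ := fun r => rowContent n (S₀ r)
      let S : Fin n → Fin n → ℤ := fun r c => S₀ r c / (g r : ℤ)
      (if (i : ℕ) % 2 = 0 then 1 else -1) * (Int.sign p) ^ (n + 1) * gsign n S

/-- `signAt` with the Gaussian sign. [folklore] -/
def signAtG (m K D : ℕ) (d : Fin K → ℕ) (S : Fin K → Fin m → Fin m → ℤ) (a b : ℕ) : ℤ :=
  gsign m (evalAt m K D d S a b)

/-- `certCheck` with the Gaussian sign (same four conjuncts). [folklore] -/
def certCheckG (m K N : ℕ) (d : Fin K → ℕ) (S : Fin K → Fin m → Fin m → ℤ) (a b : Fin (N + 1) → ℕ) : Bool :=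
  finAll K (fun l => finAll m (fun i => finAll m (fun j => S l i j == S l j i)))
  && (finAll (N + 1) (fun j => decide (0 < a j) && decide (0 < b j))
  && (finAll N (fun i => decide (a i.castSucc * b i.succ < a i.succ * b i.castSucc))
  && finAll N (fun i => signAtG m K (finMax K d) d S (a i.castSucc) (b i.castSucc)
        * signAtG m K (finMax K d) d S (a i.succ) (b i.succ) == -1)))

/-! ### Soundness -/

/-- `firstNz = none` ⇒ the whole column vanishes. [folklore] -/
theorem firstNz_none {n : ℕ} {f : Fin n → ℤ} (h : firstNz n f = none) : ∀ i, f i = 0 := by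
  induction n with
  | zero => intro i; exact i.elim0
  | succ n ih =>
    intro i
    simp only [firstNz] at h
    split_ifs at h with h0
    · simp only [ne_eq, Decidable.not_not] at h0
      cases i using Fin.cases with
      | zero => exact h0
      | succ j =>
        have h' : firstNz n (fun i => f i.succ) = none := by
          cases hq : firstNz n (fun i => f i.succ) with
          | none => rfl
          | some v => rw [hq] at h; simp at h
        exact ih h' j

/-- `firstNz = some i` ⇒ `f i ≠ 0`. [folklore] -/
theorem firstNz_some {n : ℕ} {f : Fin n → ℤ} {i : Fin n} (h : firstNz n f = some i) : f i ≠ 0 := by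
  induction n with
  | zero => exact i.elim0
  | succ n ih =>
    simp only [firstNz] at h
    split_ifs at h with h0
    · simp only [Option.some.injEq] at h
      subst h; exact h0
    · cases hq : firstNz n (fun i => f i.succ) with
      | none => rw [hq] at h; simp at h
      | some v =>
        rw [hq] at h
        simp only [Option.map_some, Option.some.injEq] at h
        subst h
        exact ih hq

/-- the row content is positive. [folklore] -/
theorem rowContent_pos (n : ℕ) (f : Fin n → ℤ) : 0 < rowContent n f := by
  unfold rowContent; exact lt_of_lt_of_le Nat.zero_lt_one (le_max_left _ _)

/-- the structural gcd divides every entry. [folklore] -/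
theorem finGcd_dvd (n : ℕ) (f : Fin n → ℤ) (i : Fin n) : (rowContent.finGcd n f : ℤ) ∣ f i := by
  induction n with
  | zero => exact i.elim0
  | succ n ih =>
    simp only [rowContent.finGcd]
    cases i using Fin.cases with
    | zero =>
      exact Int.natCast_dvd.mpr (Nat.gcd_dvd_left _ _) |> fun h => by simpa using h
    | succ j =>
      have h1 : (Nat.gcd (f 0).natAbs (rowContent.finGcd n (fun i => f i.succ)) : ℤ)
          ∣ (rowContent.finGcd n (fun i => f i.succ) : ℤ) :=
        Int.natCast_dvd_natCast.mpr (Nat.gcd_dvd_right _ _)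
      exact h1.trans (ih (fun i => f i.succ) j)

/-- the row content divides every entry. [folklore] -/
theorem rowContent_dvd (n : ℕ) (f : Fin n → ℤ) (i : Fin n) : (rowContent n f : ℤ) ∣ f i := by
  unfold rowContent
  by_cases hG : rowContent.finGcd n f = 0
  · -- gcd = 0 forces every entry 0
    have hz : f i = 0 := by
      have h := finGcd_dvd n f i
      rw [hG] at h
      simpa using h
    rw [hz]; exact dvd_zero _
  · have h1 : 1 ≤ rowContent.finGcd n f := Nat.one_le_iff_ne_zero.mpr hG
    rw [max_eq_right h1]; exact finGcd_dvd n f i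

/-- sign of a power. [folklore] -/
theorem sign_pow' (p : ℤ) (k : ℕ) : Int.sign (p ^ k) = Int.sign p ^ k := by
  induction k with
  | zero => simp
  | succ k ih => rw [pow_succ, Int.sign_mul, ih, pow_succ]

/-- **`gsign` is the sign of the determinant.** [folklore] -/
theorem gsign_eq (n : ℕ) (M : Fin n → Fin n → ℤ) : gsign n M = Int.sign (Matrix.of M).det := by
  induction n with
  | zero => simp [gsign, Matrix.det_fin_zero]
  | succ n ih =>
    simp only [gsign]
    cases hq : firstNz (n + 1) (fun r => M r 0) with
    | none =>
      -- zero first column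
      have hcol : ∀ r, (Matrix.of M) r 0 = 0 := fun r => firstNz_none hq r
      rw [Matrix.det_eq_zero_of_column_eq_zero 0 hcol]; simp
    | some i =>
      simp only
      have hp : M i 0 ≠ 0 := firstNz_some (f := fun r => M r 0) hq
      set p : ℤ := M i 0 with hpdef
      set S₀ : Fin n → Fin n → ℤ := fun r c => p * M (i.succAbove r) c.succ - M (i.succAbove r) 0 * M i c.succ with hS₀
      set g : Fin n → ℕ := fun r => rowContent n (S₀ r) with hg
      set S : Fin n → Fin n → ℤ := fun r c => S₀ r c / (g r : ℤ) with hS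
      -- (1) scaled-and-reduced matrix N: row i kept, other rows r ↦ p·row r − (M r 0)·row i
      let N : Matrix (Fin (n+1)) (Fin (n+1)) ℤ :=
        Matrix.of fun r c => if r = i then M i c else p * M r c - M r 0 * M i c
      -- (1a) scaling step: B := rows r ≠ i multiplied by p
      let v : Fin (n+1) → ℤ := fun r => if r = i then 1 else p
      let B : Matrix (Fin (n+1)) (Fin (n+1)) ℤ := Matrix.of fun r c => v r * (Matrix.of M) r c
      have hB : B.det = (∏ r, v r) * (Matrix.of M).det := Matrix.det_mul_column v (Matrix.of M)
      have hv : (∏ r, v r) = p ^ n := by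
        rw [Fin.prod_univ_succAbove v i]
        have hvi : v i = 1 := if_pos rfl
        have hvr : ∀ r : Fin n, v (i.succAbove r) = p := fun r => if_neg (Fin.succAbove_ne i r)
        simp only [hvi, hvr, one_mul, Fin.prod_const]
      -- (1b) elimination step: N r c = B r c + c_r * B i c with c_i = 0
      have hNB : N.det = B.det := by
        refine Matrix.det_eq_of_forall_row_eq_smul_add_const (fun r => if r = i then 0 else -M r 0) i (if_pos rfl) ?_
        intro r c
        by_cases hr : r = i
        · subst hr; simp [N, B, v]
        · simp [N, B, v, hr]; ring
      -- (2) Laplace along column 0 of N: only row i survives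
      have hcol : ∀ r, r ≠ i → N r 0 = 0 := by
        intro r hr; simp [N, hr, hpdef]; ring
      have hNi : N i 0 = p := by simp [N, hpdef]
      have hsub : N.submatrix i.succAbove Fin.succ = Matrix.of S₀ := by
        ext r c
        simp [N, Matrix.submatrix_apply, Fin.succAbove_ne i r, hS₀, hpdef]
      have hLap : N.det = (-1) ^ (i : ℕ) * p * (Matrix.of S₀).det := by
        rw [Matrix.det_succ_column_zero, Finset.sum_eq_single i]
        · rw [hNi, hsub]
        · intro r _ hr; rw [hcol r hr]; ring
        · intro h; exact absurd (Finset.mem_univ i) h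
      -- (3) content division: S₀ r c = g r * S r c
      have hdiv : ∀ r c, S₀ r c = (g r : ℤ) * S r c := by
        intro r c
        simp only [hS]
        rw [Int.mul_ediv_cancel' (rowContent_dvd n (S₀ r) c)]
      have hS₀S : (Matrix.of S₀).det = (∏ r, (g r : ℤ)) * (Matrix.of S).det := by
        have : Matrix.of S₀ = Matrix.of (fun r c => (g r : ℤ) * (Matrix.of S) r c) := by
          ext r c; simp [hdiv]
        rw [this]; exact Matrix.det_mul_column (fun r => (g r : ℤ)) (Matrix.of S)
      have hgpos : 0 < ∏ r, (g r : ℤ) := Finset.prod_pos (fun r _ => by exact_mod_cast rowContent_pos n (S₀ r))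
      -- (4) assemble signs:  p^n · det M = (−1)^i · p · (∏ g) · det S
      have hmain : p ^ n * (Matrix.of M).det = (-1) ^ (i : ℕ) * p * ((∏ r, (g r : ℤ)) * (Matrix.of S).det) := by
        rw [← hv, ← hB, ← hNB, hLap, hS₀S]
      rw [ih S]
      -- take Int.sign of hmain
      have hsg := congrArg Int.sign hmain
      rw [Int.sign_mul, Int.sign_mul, Int.sign_mul, Int.sign_mul, sign_pow' , sign_pow',
        Int.sign_eq_one_of_pos hgpos, one_mul] at hsg
      -- sign(−1) = −1, sign(p)² = 1
      have hp1 : Int.sign p * Int.sign p = 1 := by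
        rcases lt_trichotomy p 0 with h | h | h
        · rw [Int.sign_eq_neg_one_of_neg h]; norm_num
        · exact absurd h hp
        · rw [Int.sign_eq_one_of_pos h]; norm_num
      have hneg1 : Int.sign (-1 : ℤ) = -1 := by decide
      rw [hneg1] at hsg
      -- multiply both sides of hsg by sign(p)^n
      have key : Int.sign (Matrix.of M).det
          = (-1) ^ (i : ℕ) * Int.sign p ^ (n + 1) * Int.sign (Matrix.of S).det := by
        have h2 : Int.sign p ^ n * Int.sign p ^ n = 1 := by
          rw [← mul_pow, hp1, one_pow]
        calc Int.sign (Matrix.of M).det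
            = (Int.sign p ^ n * Int.sign p ^ n) * Int.sign (Matrix.of M).det := by rw [h2, one_mul]
          _ = Int.sign p ^ n * (Int.sign p ^ n * Int.sign (Matrix.of M).det) := by ring
          _ = Int.sign p ^ n * ((-1) ^ (i : ℕ) * Int.sign p * Int.sign (Matrix.of S).det) := by rw [hsg]
          _ = (-1) ^ (i : ℕ) * Int.sign p ^ (n + 1) * Int.sign (Matrix.of S).det := by ring
      rw [key]
      rcases Nat.even_or_odd (i : ℕ) with hi | hi
      · rw [if_pos (Nat.even_iff.mp hi), hi.neg_one_pow]
      · rw [if_neg (by rw [Nat.odd_iff.mp hi]; decide), hi.neg_one_pow]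

/-- `signAtG = signAt`. [folklore] -/
theorem signAtG_eq (m K D : ℕ) (d : Fin K → ℕ) (S : Fin K → Fin m → Fin m → ℤ) (a b : ℕ) :
    signAtG m K D d S a b = signAt m K D d S a b := by
  unfold signAtG signAt
  rw [gsign_eq, idet_eq]

/-- `certCheckG = certCheck`. [folklore] -/
theorem certCheckG_eq (m K N : ℕ) (d : Fin K → ℕ) (S : Fin K → Fin m → Fin m → ℤ) (a b : Fin (N + 1) → ℕ) :
    certCheckG m K N d S a b = certCheck m K N d S a b := by
  unfold certCheckG certCheck
  simp only [signAtG_eq]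

/-- **Reflective certificate (Gaussian sign) ⇒ row**: eng-10's `not_posRootLawAt_of_certCheck` with `certCheckG`. [folklore] -/
theorem not_posRootLawAt_of_certCheckG {m K N B : ℕ} {d : Fin K → ℕ} {S : Fin K → Fin m → Fin m → ℤ}
    {a b : Fin (N + 1) → ℕ} (h : certCheckG m K N d S a b = true) (hB : B < N) :
    ¬ PosRootLawAt m K B :=
  not_posRootLawAt_of_certCheck (by rwa [certCheckG_eq] at h) hB

/-! ### Smoke test: the kit's toy row, now through `gsign`. -/

/-- `ζ(2,2) ≥ 2` for the toy pencil `diag(−1,−2) + t·1`, by the Gaussian reflective check (an `example`: the statement is the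
kit's `toy_not_posRootLawAt_2_2_1`). [folklore] -/
example : ¬ PosRootLawAt 2 2 1 :=
  not_posRootLawAt_of_certCheckG (m := 2) (K := 2) (N := 2) (d := ![0, 1])
    (S := ![![![-1, 0], ![0, -2]], ![![1, 0], ![0, 1]]]) (a := ![1, 3, 4]) (b := ![2, 2, 1])
    (by decide +kernel) (by norm_num)

end Summit.ValiantsHypothesis.ValiantsHypothesis.Theorems.LacunarySymmetroidMatrixDescartes.Census.Reflect
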